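import Summits.QuantumFields.YangMills.Theorems.AlphaInputsT3ACv3NewtonLiftStencilRows
import Summits.QuantumFields.YangMills.Theorems.AlphaInputsT3ACv3StartDefectTwoCellTgt
import HarnessLib

/-!
# `AlphaInputsT3ACv3NewtonLiftStencilRowsTgt` — STRATEGY B for 2′, the (FL) row under OWNER RULING g24-№4, MAP #3 M22: **THE STENCIL-GAUGE ROWS OF THE REGIONAL NEWTON LIFT READ
# FROM THE CENTRE OF `c₊`, AND THE `hosc` BINDER OF THE KERNEL CERTIFICATE DISCHARGED FROM THE TWO-CELL PLAQUETTE BOUND** — the `_tgt` twin of ★w4 g2's `norm_gaugeAct_centreAxial_sub_one_le`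
# (flatness of `U^{σ}` for the comb gauge `σ = axialT U (toFine k c₊)` on every bond of the two `k`-blocks of `c`, over ★w5 g2's chart `…StartDefectTwoCellTgt`), and ★★ `osc_centreAxial_of_twoCell`:
# the oscillation hypothesis (γ) of `exists_obLift_gaugeKernel` for the centre-anchored comb gauges `σ_c := axialT U (toFine k c₋)` holds with `ω = 2·(d⌊L^k∕2⌋ + L^k)·δ·(d⌊L^k∕2⌋)` whenever
# the plaquettes of the two-cell box of `c` are within `δ` of `1` — lane `pub-balaban3d` ∕ cell `ym3-torus`, seat `ym-ust-19936-w4` (g3)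

WHY (cell `ym3-torus` 2026-08-28: ★★OWNER g25 (J) 03:44:03Z «the M22 SKELETON `hLift_clause_of_start` … from DISPLAYED START rows + (K1)–(K7) = ★w4»; ★w4 g2 HANDOFF «(γ)'s `hosc` from p603352
`norm_relGauge_centre_osc_le` … face-straddling gauges via ★w5's `…TwoCellTgt` + a 5-line `_tgt` twin»).  In `exists_obLift_gaugeKernel` (γ) the relative gauge `σ_cσ_{c′}⁻¹` is compared with
its value at the centre of the block of `c′₋ = coarsen k b₋ ∈ {c₋, c₊}`; `σ_{c′} = axialT U (toFine k c′₋)` is the comb gauge from the centre of `c₋` (★w4 g2 §1) or of `c₊` (THIS file §1),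
and both are flat on that block from the SAME two-cell plaquette bound.
WHAT (def-free): §1 ★ `norm_gaugeAct_centreAxial_sub_one_le_tgt`; §2 ★★ `osc_centreAxial_of_twoCell` (the `hosc` binder of (γ) at `σ c := axialT U (toFine k c₋)`, `ω := (Dδ + Dδ)·(d⌊L^k∕2⌋)`,
`D = d⌊L^k∕2⌋ + L^k`; needs `d ≥ 2`, `k ≤ m + K`, `4L^k ≤ sitesPerDir 0`).
HONEST FRAMING.  Bookkeeping over ★w5's two charts, ★w1 g0's regional axial gauge and ★w4 g2's (G)∕§2; the plaquette bound on the two-cell box is the START's; `hLift`, the stub 2′χ, the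
crux `HistoryTailL` and any gap are NOT claimed; count-neutral helper toward R3 2′ (items 19936∕19935); registry untouched; nothing about d = 4, the continuum, or a mass gap; YM₃ on T³
is rung R3, not Clay.

References: T. Bałaban, Commun. Math. Phys. 98 (1985) 17–51 [Balaban1985Averaging] ((8) p.18, (19) p.21, pp.24–25); CMP 102 (1985) 277–309 [Balaban1985Variational] ((18) p.280);
CMP 109 (1987) 249–301 [Balaban1987RG1] ((0.1) p.251).
-/

set_option autoImplicit false

noncomputable section

open scoped Matrix.Norms.L2Operator
namespace Summit.QuantumFields.YangMills.Theorems.NewtonLiftFramed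

open Literature.MathematicalPhysics.QuantumFieldTheory.Balaban1983to89
open T4Continuum
open B10Eq27TorusAxialLog (axialT gaugeActT rel rel_apply gaugeActT_eq_gaugeAct)
open B7Prop1Explicit (l1)
open Literature.MathematicalPhysics.QuantumFieldTheory.Balaban1983to89.B5Eq118OneStroke (iterBlockOf)
open Literature.MathematicalPhysics.QuantumFieldTheory.Balaban1983to89.B10Eq38TorusDomains (toFine)
open Summit.QuantumFields.YangMills.Theorems.StartDefectBox (twoCellSet hwrap_twoCell_tgt hfan_twoCell_tgt hl1_twoCell_tgt)
open Summit.QuantumFields.YangMills.Theorems.RegionAxialGauge (dist1_gaugeActT_axialT_le_of_box)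
open Summit.QuantumFields.YangMills.Theorems.PerturbedPlaquette (dist1_SU_eq)

variable {P : Params} {k : ℕ} {n : Type*} [Fintype n] [DecidableEq n] [Nonempty n]

/-! ## §1 The stencil-gauge flatness row read from the centre of `c₊` -/

/-- **★ THE `hU₀`-TYPE FLATNESS FOR THE COMB GAUGE FROM THE CENTRE OF `c₊`** (`k ≤ m + K`, `4L^k ≤ sitesPerDir 0`): if every finest plaquette with lower and upper corners in the two-cell
product set of `c` is within `δ ≥ 0` of `1`, then for `σ = axialT U (toFine k c₊)` and every finest bond `b` with both endpoints in the two `k`-blocks of `c`,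
`‖(U^{σ})_b − 1‖ ≤ (d·⌊L^k∕2⌋ + L^k)·δ` (the `_tgt` twin of `norm_gaugeAct_centreAxial_sub_one_le`, over ★w5's `hwrap_twoCell_tgt`∕`hfan_twoCell_tgt`∕`hl1_twoCell_tgt`).
[cite: Balaban1985Averaging, (8) p.18, pp.24–25; Balaban1985Variational, (18) p.280] -/
theorem norm_gaugeAct_centreAxial_sub_one_le_tgt (hk : k ≤ P.m + P.K) (hN4 : 4 * P.L ^ k ≤ P.sitesPerDir 0) (U : GaugeField P 0 (Matrix.specialUnitaryGroup n ℂ)) (c : PBond P k)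
    {δ : ℝ} (hδ : 0 ≤ δ)
    (hU : ∀ q : Plaq P 0, (∀ κ, q.src κ ∈ twoCellSet k c κ) → (∀ κ, ((q.src.shift q.μ).shift q.ν) κ ∈ twoCellSet k c κ) → GaugeGroup.dist1 (GaugeField.plaqHol U q) ≤ δ)
    (b : PBond P 0) (hs : iterBlockOf k b.src = c.src ∨ iterBlockOf k b.src = c.tgt) (ht : iterBlockOf k b.tgt = c.src ∨ iterBlockOf k b.tgt = c.tgt) :
    ‖((GaugeField.gaugeAct (axialT U (toFine k c.tgt)) U b : Matrix.specialUnitaryGroup n ℂ) : Matrix n n ℂ) - 1‖ ≤ ((P.d * (P.L ^ k / 2) + P.L ^ k : ℕ) : ℝ) * δ := by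
  obtain ⟨x, μ⟩ := b
  have ht' : iterBlockOf k (x.shift μ) = c.src ∨ iterBlockOf k (x.shift μ) = c.tgt := ht
  have h := dist1_gaugeActT_axialT_le_of_box U (I := twoCellSet k c) hδ (fun q h1 h2 => hU q h1 h2) (toFine k c.tgt) x μ (hwrap_twoCell_tgt hk hN4 c x hs μ)
    (fun κ t ht1 ht2 => hfan_twoCell_tgt hk hN4 c x hs μ ht' κ t ht1 ht2)
  have hl := hl1_twoCell_tgt hk hN4 c x hs
  rw [← dist1_SU_eq, ← gaugeActT_eq_gaugeAct]
  refine h.trans (mul_le_mul_of_nonneg_right (by exact_mod_cast hl) hδ)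

/-! ## §2 The `hosc` binder of the kernel certificate from the two-cell plaquette bound -/

/-- **★★ THE `hosc` BINDER OF `exists_obLift_gaugeKernel` (γ) AT THE CENTRE-ANCHORED COMB GAUGES, FROM THE TWO-CELL PLAQUETTE BOUND** (`d ≥ 2`, `k ≤ m + K`, `4L^k ≤ sitesPerDir 0`).  If
every finest plaquette with lower and upper corners in the two-cell product set of `c` is within `δ ≥ 0` of `1`, then for every finest bond `b` with source in the two `k`-blocks of `c` and every
coarse bond `c′` with `c′₋ = iterBlockOf k b₋`, the relative gauge `σ_cσ_{c′}⁻¹` of `σ_c = axialT U (toFine k c₋)`, `σ_{c′} = axialT U (toFine k c′₋)` satisfies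
`‖σ_c(b₋)σ_{c′}(b₋)⁻¹ − σ_c^{(k)}(c′₋)σ_{c′}^{(k)}(c′₋)⁻¹‖ ≤ (Dδ + Dδ)·(d⌊L^k∕2⌋)`, `D = d⌊L^k∕2⌋ + L^k`: both gauged fields are `Dδ`-flat on the block of `c′₋ ∈ {c₋, c₊}` (§1 here and
★w4 g2's §1), then ★w4 g2's `norm_relGauge_centre_osc_le`. [cite: Balaban1985Averaging, (8) p.18, (19) p.21, pp.24–25; Balaban1987RG1, (0.1) p.251] -/
theorem osc_centreAxial_of_twoCell (hd : 2 ≤ P.d) (hk : k ≤ P.m + P.K) (hN4 : 4 * P.L ^ k ≤ P.sitesPerDir 0) (U : GaugeField P 0 (Matrix.specialUnitaryGroup n ℂ)) (c : PBond P k)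
    {δ : ℝ} (hδ : 0 ≤ δ)
    (hU : ∀ q : Plaq P 0, (∀ κ, q.src κ ∈ twoCellSet k c κ) → (∀ κ, ((q.src.shift q.μ).shift q.ν) κ ∈ twoCellSet k c κ) → GaugeGroup.dist1 (GaugeField.plaqHol U q) ≤ δ)
    (b : PBond P 0) (hs : iterBlockOf k b.src = c.src ∨ iterBlockOf k b.src = c.tgt) (c' : PBond P k) (hc' : c'.src = iterBlockOf k b.src) :
    ‖((axialT U (toFine k c.src) b.src * (axialT U (toFine k c'.src) b.src)⁻¹ : Matrix.specialUnitaryGroup n ℂ) : Matrix n n ℂ) -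
        ((transfUp (axialT U (toFine k c.src)) k c'.src * (transfUp (axialT U (toFine k c'.src)) k c'.src)⁻¹ : Matrix.specialUnitaryGroup n ℂ) : Matrix n n ℂ)‖ ≤
      (((P.d * (P.L ^ k / 2) + P.L ^ k : ℕ) : ℝ) * δ + ((P.d * (P.L ^ k / 2) + P.L ^ k : ℕ) : ℝ) * δ) * ((P.d * (P.L ^ k / 2) : ℕ) : ℝ) := by
  have hDδ : 0 ≤ ((P.d * (P.L ^ k / 2) + P.L ^ k : ℕ) : ℝ) * δ := by positivity
  have hy : iterBlockOf k b.src = c'.src := hc'.symm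
  have hy2 : c'.src = c.src ∨ c'.src = c.tgt := by rw [hc']; exact hs
  -- `σ_c` is flat on the block of `c′₋` (one of the two blocks of `c`)
  have hg : ∀ b' : PBond P 0, iterBlockOf k b'.src = c'.src → iterBlockOf k b'.tgt = c'.src →
      ‖((GaugeField.gaugeAct (axialT U (toFine k c.src)) U b' : Matrix.specialUnitaryGroup n ℂ) : Matrix n n ℂ) - 1‖ ≤ ((P.d * (P.L ^ k / 2) + P.L ^ k : ℕ) : ℝ) * δ :=
    fun b' h1 h2 => norm_gaugeAct_centreAxial_sub_one_le hk hN4 U c hδ hU b' (by rw [h1]; exact hy2) (by rw [h2]; exact hy2)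
  -- `σ_{c′}` is flat on the block of `c′₋`: from the centre of `c₋` or of `c₊`
  have hg' : ∀ b' : PBond P 0, iterBlockOf k b'.src = c'.src → iterBlockOf k b'.tgt = c'.src →
      ‖((GaugeField.gaugeAct (axialT U (toFine k c'.src)) U b' : Matrix.specialUnitaryGroup n ℂ) : Matrix n n ℂ) - 1‖ ≤ ((P.d * (P.L ^ k / 2) + P.L ^ k : ℕ) : ℝ) * δ := by
    rcases hy2 with e | e
    · intro b' h1 h2
      rw [e]
      rw [e] at h1 h2
      exact norm_gaugeAct_centreAxial_sub_one_le hk hN4 U c hδ hU b' (Or.inl h1) (Or.inl h2)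
    · intro b' h1 h2
      rw [e]
      rw [e] at h1 h2
      exact norm_gaugeAct_centreAxial_sub_one_le_tgt hk hN4 U c hδ hU b' (Or.inr h1) (Or.inr h2)
  exact norm_relGauge_centre_osc_le hd hk hN4 (axialT U (toFine k c.src)) (axialT U (toFine k c'.src)) U c'.src hDδ hDδ hg hg' b.src hy

end Summit.QuantumFields.YangMills.Theorems.NewtonLiftFramed

end
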